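import Summits.BirchSwinnertonDyer.Rank1Residual.Additive.X4RankZeroKatoBound
import Summits.BirchSwinnertonDyer.Rank1Residual.Additive.X4RankZeroUpperBoundThree
import Summits.BirchSwinnertonDyer.Rank1Residual.AdditivePotMult.RankZeroChiBranchThreeFacts
import Summits.BirchSwinnertonDyer.Rank1Residual.GaloisImage.JWitnessTowerSurjectivity
import HarnessLib

/-!
# X4♯(3) ASSEMBLED: the conjecture's conclusion on every row with a potentially multiplicative `3`
# OR a `3`-adic surjectivity certificate (`j`-witness / mod-9) and `3 ∤ ∏ c_ℓ`; the REDUCTION of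
# X4♯(3) to its residue (cell `b2b-bsdres`, seat additive-p4, line V21)

HONEST FRAMING (cell `b2b-bsdres`, run/shared/lean/b2b/bsd-rank1-residual/, verbatim in every
file): the goal of the cell is to DELETE the COMBINATION-SHAPED residual classes of the
Birch–Swinnerton-Dyer formula for ALL analytic-rank `≤ 1` elliptic curves over `ℚ` — "full BSD
formula for every rank `≤ 1` curve in class `C`" assembled STRICTLY from published theorems — so
that the rank-`≤ 1` remainder becomes exactly the CONSTRUCTION-SHAPED classes, which are TYPED
(missing-input `Prop`s), NOT attempted. This is not "finishing BSD". Sub-cell additive-p4 (X3♯/X4♯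
direct): research route on the CONSTRUCTION-SHAPED class X4; no claim beyond the stated classes;
the label X4 is UNCHANGED by this file; nothing is booked. Theorems only (pure compositions of tree
theorems; no definition, no named fact minted).

## What is assembled

`Additive.X4SharpThree` (SHARPENED §4 (i), the largest single block of the residue: 1582 ‖ 417
unit rows) says: for `E/ℚ` of analytic rank `0` in class X4 at `p = 3` with `ρ̄_{E,3}` onto and a
modular parametrisation datum `D` with `3 ∤ c_D`, `ord₃ #Ш(E) ≤ ord₃ #Ш_an(E) + ord₃ ∏ c_ℓ(E)`.
Two PUBLISHED routes now reach it, on complementary sub-blocks: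

* **(M) `ord₃ j(E) < 0`** (potentially multiplicative `3`): sub-cell additive-p1's
  `AdditivePotMult.ClassX4M.missingUpperBoundAt_three_rankZero_of_surj` (Delbourgo 1998 Prop. 4 +
  the `ω`-component of Kato's divisibility over `ℚ(ζ_{3^∞})` for the multiplicative twist
  `E^{(−3)}` + Wuthrich 2014 Lemma 20 + GZK + modularity) gives the typed UPPER HALF
  `ord₃ #Ш ≤ ord₃ #Ш_an` — hence the conjecture's (weaker) inequality — with NO Tamagawa, NO Manin,
  NO (ram) hypothesis (`x4SharpThree_conclusion_of_potMult`).
* **(G) `ord₃ j(E) ≥ 0`** (potentially good `3`, tame AND wild): this seat's V20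
  `X4RankZero.padicValNat_shaOrder_le_of_kato` (Kato 2004 Thm. 14.5 (3) + Prop. 14.16 (2) + Kim 2026
  L. 3.10) needs `ρ̄_{E,3^n}` onto ∀ `n` and `3 ∤ ∏ c_ℓ`; tower surjectivity is now fed by ANY of:
  a `j`-WITNESS (prime `q ≠ 3`, `ord_q j < 0`, `3 ∤ ord_q j` — multiplicative or additive
  potentially multiplicative `q`; `GaloisImage.hasSurjectiveModNGaloisRep_pow_of_surj_of_jWitness`,
  line V21), the old (ram) bit (a special `j`-witness), or a mod-`9` certificate
  (`forall_hasSurjectiveModNGaloisRep_three_pow_of_nine`).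

Theorems: §0 tower surjectivity at `3` from the certificates; §1 the `j`-witness forms of the Kato
and Kim–Nakamura consumers (`…_of_jWitness`); §2 `x4SharpThree_conclusion_of_potMult`,
`x4SharpThree_conclusion_of_potMult_or_towerSurj`,
**`x4SharpThree_conclusion_of_cert`** (the conjecture's conclusion from `ord₃ j < 0 ∨` [a tower
certificate `∧ 3 ∤ ∏ c_ℓ`]); §3 **`X4RankZero.bsdp_three_of_cert_of_shaAn_unit`** (`BSD(E,3)` on
every X4♯(3) unit row carrying `ord₃ j < 0`, a `j`-witness, or surj(9)) and the upper-half /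
lower-half forms. The REDUCTION of X4♯(3) to its residue (`x4SharpThree_iff_residue`,
`x4SharpThree_of_censusResidue`) is the sibling file `Additive/X4SharpThreeResidue.lean`.

Census (seat, engine A bits + a-invariants; V21-CENSUS): of the 1 965 X4 ∧ `p = 3` ∧ `r_an = 0` ∧
surj(3) window rows (N < 2·10⁴) the conjecture's conclusion is a theorem modulo the named facts on
the 857 (M) rows and on the pot-good rows with a `j`-witness and `3 ∤ ∏ c_ℓ`; of the 1 582 unit rows
(block B of X4♯(3)) **1 546** get `BSD(E,3)` (866 V20 + 10 new `j`-witness rows + 670 (M) rows),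
residue **36** (pot-good, no `j`-witness: a mod-9 certificate closes each); S-b sweep (N < 5·10⁵):
142 628 of 144 122 unit rows, residue 1 494. Numbers of record are the census files', not this
docstring's. X4 stays CONSTRUCTION-SHAPED (the LOWER half on `3 ∣ #Ш_an` rows, the `3 ∣ ∏ c_ℓ`
pot-good rows, the non-surjective rows and rank 1 are untouched); nothing booked.

References: Kato 2004 [Kato2004Asterisque] Thm. 14.5 (3), Prop. 14.16 (2), Thm. 17.4 (3);
Kim–Nakamura 2020 [KimNakamura2020] Thm. 4.2 (2), Cor. 2.4, Rem. 1.8 (1); Delbourgo 1998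
[Delbourgo1998] Prop. 4; Wuthrich 2014 [Wuthrich2014] Lemma 20, Cor. 19; Miller 2011 [Miller2011LMS]
Def. 1.1; Silverman *AEC* X.5.4, *ATAEC* V.5.3; Serre 1968 IV §3.4.
-/

noncomputable section

open scoped Classical

open WeierstrassCurve Literature.NumberTheory.EllipticCurves
  Literature.NumberTheory.EllipticCurves.ModularForms
  Literature.NumberTheory.EllipticCurves.Rank1Residual
  Literature.NumberTheory.EllipticCurves.Rank1Residual.Typed

namespace Summit.BirchSwinnertonDyer.Rank1Residual.Additive

variable (W : WeierstrassCurve ℚ) [W.IsElliptic] [W.IsGloballyMinimal]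

/-! ### §0 Tower surjectivity at `3` from a `j`-witness (cast bookkeeping) -/

omit [W.IsGloballyMinimal] in
/-- `ρ̄_{E,3^n}` onto for all `n` from surj(3) and a `j`-witness with the literal `(3 : ℤ)`
(`GaloisImage.hasSurjectiveModNGaloisRep_pow_of_surj_of_jWitness` at `p = 3`; any model).
[cite: SilvermanATAEC1994, V.5.3 and Exercise 5.13(b) (PDF p. 416)] -/
theorem towerSurj_three_of_surj_of_jWitness (hsurj : Surj W 3)
    (hJ : ∃ q : ℕ, q.Prime ∧ q ≠ 3 ∧ padicValRat q W.j < 0 ∧ ¬ (3 : ℤ) ∣ padicValRat q W.j)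
    (n : ℕ) : W.HasSurjectiveModNGaloisRep (3 ^ n : ℕ) := by
  refine GaloisImage.hasSurjectiveModNGaloisRep_pow_of_surj_of_jWitness W 3 hsurj ?_ n
  obtain ⟨q, hq, hq3, hneg, hnd⟩ := hJ
  exact ⟨q, hq, hq3, hneg, by exact_mod_cast hnd⟩

omit [W.IsGloballyMinimal] in
/-- **The census certificates of `3`-adic surjectivity give the tower**: surj(3) together with a
`j`-witness OR surj(9) implies `ρ̄_{E,3^n}` onto for all `n`.
[cite: SerreAbelianLadic1968, Ch. IV §3.4, Lemma 3 (IV-23)] -/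
theorem towerSurj_three_of_surj_of_jWitness_or_nine (hsurj : Surj W 3)
    (hcert : (∃ q : ℕ, q.Prime ∧ q ≠ 3 ∧ padicValRat q W.j < 0 ∧ ¬ (3 : ℤ) ∣ padicValRat q W.j) ∨
      W.HasSurjectiveModNGaloisRep 9)
    (n : ℕ) : W.HasSurjectiveModNGaloisRep (3 ^ n : ℕ) := by
  rcases hcert with hJ | h9
  · exact towerSurj_three_of_surj_of_jWitness W hsurj hJ n
  · exact WeierstrassCurve.forall_hasSurjectiveModNGaloisRep_three_pow_of_nine W h9 n

/-! ### §1 The Kato and Kim–Nakamura consumers with a `j`-witness -/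

/-- **V21 — `BSD(E,3)` on X4 ∧ `r_an = 0` ∧ `ord₃ j ≥ 0` ∧ surj(3) ∧ `j`-witness ∧ units** (Kato 2004
Thm. 14.5 (3) + Prop. 14.16 (2) `hKato`, GZK, modularity; `3 ∤ ∏ c_ℓ`, `#Ш_an` a `3`-unit, datum `D`
with `3 ∤ c_D`): as `X4RankZero.bsdp_three_of_kato_of_surj_of_ram` with the (ram) bit replaced by a
`j`-witness (a prime `q ≠ 3` with `ord_q j < 0`, `3 ∤ ord_q j`, possibly ADDITIVE for `E`).
[cite: Kato2004Asterisque, Thm. 14.5 (3) (p. 236), (12.5.2) (p. 222)] [cite: Miller2011LMS, §1 and Def. 1.1] -/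
theorem X4RankZero.bsdp_three_of_kato_of_surj_of_jWitness
    (hKato : Kato2004.rankZero_padicValNat_sha_le_of_additive_potGood_of_imageContainsSL2)
    (hGZK : rank_eq_analyticRank_of_analyticRank_le_one) (hmod : hasEntireLFunction_rat)
    (hr : W.analyticRank = 0) (hX : ClassX4 W 3) (hpot : 0 ≤ padicValRat 3 W.j) (hsurj : Surj W 3)
    (hJ : ∃ q : ℕ, q.Prime ∧ q ≠ 3 ∧ padicValRat q W.j < 0 ∧ ¬ (3 : ℤ) ∣ padicValRat q W.j)
    (htam : ¬ 3 ∣ W.tamagawaProduct)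
    {N : ℕ} [NeZero N] (D : ModularParametrizationData W N) (hc : ¬ (3 : ℤ) ∣ D.maninConstant)
    {q : ℚ} (hq : shaAn W = (q : ℂ)) (hv : padicValRat 3 q = 0) : BSDp W 3 :=
  X4RankZero.bsdp_of_shaAn_unit_of_kato W 3 hKato hGZK hmod hr hX hpot
    (towerSurj_three_of_surj_of_jWitness W hsurj hJ) htam D (by exact_mod_cast hc) hq hv

/-- **The typed upper half at `p = 3` with a `j`-witness** (X4 ∧ `r_an = 0` ∧ `ord₃ j ≥ 0` ∧ surj(3)
∧ `3 ∤ ∏ c_ℓ` ∧ `3 ∤ c_D`): `MissingUpperBoundAt W 3`, also on the `3 ∣ #Ш_an` rows.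
[cite: Kato2004Asterisque, Thm. 14.5 (3) (p. 236)] [cite: Miller2011LMS, Def. 1.1] -/
theorem X4RankZero.missingUpperBoundAt_three_of_kato_of_surj_of_jWitness
    (hKato : Kato2004.rankZero_padicValNat_sha_le_of_additive_potGood_of_imageContainsSL2)
    (hGZK : rank_eq_analyticRank_of_analyticRank_le_one) (hmod : hasEntireLFunction_rat)
    (hr : W.analyticRank = 0) (hX : ClassX4 W 3) (hpot : 0 ≤ padicValRat 3 W.j) (hsurj : Surj W 3)
    (hJ : ∃ q : ℕ, q.Prime ∧ q ≠ 3 ∧ padicValRat q W.j < 0 ∧ ¬ (3 : ℤ) ∣ padicValRat q W.j)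
    (htam : ¬ 3 ∣ W.tamagawaProduct)
    {N : ℕ} [NeZero N] (D : ModularParametrizationData W N) (hc : ¬ (3 : ℤ) ∣ D.maninConstant) :
    MissingUpperBoundAt W 3 :=
  X4RankZero.missingUpperBoundAt_of_kato W 3 hKato hGZK hmod hr hX hpot
    (towerSurj_three_of_surj_of_jWitness W hsurj hJ) htam D (by exact_mod_cast hc)

/-- **The `3 ∣ #Ш_an` rows with a `j`-witness: Cassels–Tate squeeze** (`ord₃ #Ш_an ≤ 2k` and
`3^{2k−1} ∣ #Ш(E)` ⟹ `BSD(E,3)`; `k = 1`: one `3`-descent certificate).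
[cite: Kato2004Asterisque, Thm. 14.5 (3) (p. 236)] [cite: SilvermanAEC2009, Thm. X.4.14] [cite: Miller2011LMS, §1 and Def. 1.1] -/
theorem X4RankZero.bsdp_three_of_kato_of_surj_of_jWitness_of_casselsTate
    (hKato : Kato2004.rankZero_padicValNat_sha_le_of_additive_potGood_of_imageContainsSL2)
    (hGZK : rank_eq_analyticRank_of_analyticRank_le_one) (hmod : hasEntireLFunction_rat)
    (hCT : exists_casselsTate_pairing (K := ℚ))
    (hr : W.analyticRank = 0) (hX : ClassX4 W 3) (hpot : 0 ≤ padicValRat 3 W.j) (hsurj : Surj W 3)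
    (hJ : ∃ q : ℕ, q.Prime ∧ q ≠ 3 ∧ padicValRat q W.j < 0 ∧ ¬ (3 : ℤ) ∣ padicValRat q W.j)
    (htam : ¬ 3 ∣ W.tamagawaProduct)
    {N : ℕ} [NeZero N] (D : ModularParametrizationData W N) (hc : ¬ (3 : ℤ) ∣ D.maninConstant)
    {q : ℚ} (hq : shaAn W = (q : ℂ)) {k : ℕ} (hv : padicValRat 3 q ≤ 2 * k)
    (hdvd : 3 ^ (2 * k - 1) ∣ W.shaOrder) : BSDp W 3 :=
  X4RankZero.bsdp_of_kato_of_casselsTate_of_pow_dvd W 3 hKato hGZK hmod hCT hr hX hpot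
    (towerSurj_three_of_surj_of_jWitness W hsurj hJ) htam D (by exact_mod_cast hc) hq hv hdvd

/-- **Kim–Nakamura route with a `j`-witness** (ANY additive type at `3`, non-exceptional,
`3 ∤ c_D · ∏ c_ℓ · ∏_{ℓ‖N}(ℓ ∓ 1) · #Ш_an`): `BSD(E,3)` — the port
`X4RankZero.bsdp_three_of_kimNakamura_of_ram_of_shaAn_unit` with (ram) replaced by a `j`-witness.
[cite: KimNakamura2020, Thm. 4.2 (2), Cor. 2.4, Rem. 1.8 (1) (arXiv pp. 4–5, 9)] [cite: Miller2011LMS, §1 and Def. 1.1] -/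
theorem X4RankZero.bsdp_three_of_kimNakamura_of_jWitness_of_shaAn_unit
    (hKN : KimNakamura2020.rankZero_padicValNat_sha_le_of_maninConstant)
    (hGZK : rank_eq_analyticRank_of_analyticRank_le_one) (hmod : hasEntireLFunction_rat)
    (hr : W.analyticRank = 0) (hX : ClassX4 W 3) (hsurj : Surj W 3)
    (hJ : ∃ q : ℕ, q.Prime ∧ q ≠ 3 ∧ padicValRat q W.j < 0 ∧ ¬ (3 : ℤ) ∣ padicValRat q W.j)
    (hexc : KimNakamura2020.NonExceptional W 3)
    (hmult : ∀ (ℓ : ℕ) [Fact ℓ.Prime], W.HasMultiplicativeReductionAtPrime ℓ →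
      (W.HasSplitMultiplicativeReductionAtPrime ℓ → ¬ 3 ∣ ℓ - 1) ∧
        (¬ W.HasSplitMultiplicativeReductionAtPrime ℓ → ¬ 3 ∣ ℓ + 1))
    {N : ℕ} [NeZero N] (D : ModularParametrizationData W N) (hc : ¬ (3 : ℤ) ∣ D.maninConstant)
    (htam : ¬ 3 ∣ W.tamagawaProduct) {q : ℚ} (hq : shaAn W = (q : ℂ)) (hv : padicValRat 3 q = 0) :
    BSDp W 3 := by
  haveI : Fact (Nat.Prime 3) := ⟨Nat.prime_three⟩
  refine bsdp_of_shaOrder_le_of_shaAn_unit W 3 hGZK (by rw [hr]; exact zero_le_one) ?_ htam hq hv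
  obtain ⟨q', hq', hle⟩ := padicValNat_shaOrder_le_of_kimNakamura_rankZero W 3 hKN hGZK hmod
    (by norm_num) hX.2.1 (Or.inr hexc) hr (towerSurj_three_of_surj_of_jWitness W hsurj hJ) htam hmult
    D (by exact_mod_cast hc)
  refine ⟨q', hq', ?_⟩
  rw [padicValNat_torsionOrder_eq_zero_of_irreducible W 3 hX.2.2] at hle
  simpa using hle

/-! ### §2 The conclusion of X4♯(3) on the two sub-blocks -/

/-- **(M) rows: X4♯(3)'s conclusion with NO Tamagawa / Manin / certificate hypothesis.** For an X4
pair `(E, 3)` of analytic rank `0` with `ρ̄_{E,3}` onto and `ord₃ j(E) < 0`, sub-cell additive-p1's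
class theorem `ClassX4M.missingUpperBoundAt_three_rankZero_of_surj` (Delbourgo 1998 Prop. 4 `hDel`,
GZK, modularity `hmod`/`hmodD`, Wuthrich 2014 Lemma 20 `hL20`, Kato's divisibility on the
`ω`-component `hKatoω`) gives `ord₃ #Ш ≤ ord₃ #Ш_an`, hence the conjecture's
`ord₃ #Ш ≤ ord₃ #Ш_an + ord₃ ∏ c_ℓ`. [cite: Delbourgo1998, Prop. 4 (p. 144)]
[cite: Wuthrich2014, Lemma 20 (p. 399), Cor. 19 (p. 398)] [cite: Kato2004Asterisque, Thm. 17.4 (3) (p. 273)] -/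
theorem x4SharpThree_conclusion_of_potMult
    (hDel : Delbourgo1998.prop4_rankZero_pow_dvd_constantCoeff)
    (hGZK : rank_eq_analyticRank_of_analyticRank_le_one) (hmod : hasEntireLFunction_rat)
    (hmodD : nonempty_modularParametrizationData)
    (hL20 : Wuthrich2014.lemma20_surjective_threeAdic_of_semistable)
    (hKatoω : Wuthrich2014.kato_minusEigenCharIdeal_dvd_cyclotomicThree_of_surjective)
    (hr : W.analyticRank = 0) (hX : ClassX4 W 3) (hsurj : Surj W 3) (hneg : padicValRat 3 W.j < 0) :
    ∃ q : ℚ, shaAn W = (q : ℂ) ∧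
      (padicValNat 3 W.shaOrder : ℤ) ≤ padicValRat 3 q + padicValNat 3 W.tamagawaProduct := by
  haveI : Fact (Nat.Prime 3) := ⟨Nat.prime_three⟩
  have hXM : AdditivePotMult.ClassX4M W 3 := ⟨hX, hX.2.1, hneg⟩
  obtain ⟨q, hq, hle⟩ := AdditivePotMult.ClassX4M.missingUpperBoundAt_three_rankZero_of_surj
    hDel hGZK hmod hmodD hL20 hKatoω hXM hr hsurj
  refine ⟨q, hq, hle.trans ?_⟩
  have h0 : (0 : ℤ) ≤ (padicValNat 3 W.tamagawaProduct : ℤ) := by exact_mod_cast Nat.zero_le _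
  linarith

/-- **X4♯(3)'s conclusion from the DICHOTOMY `ord₃ j < 0` ∨ (tower surjectivity ∧ `3 ∤ ∏ c_ℓ`)** —
all named facts of the two routes as binders; `ρ̄_{E,3}` onto, `r_an = 0`, datum `D` with `3 ∤ c_D`
as in the conjecture (on a potentially multiplicative row the (M) branch is used whatever the second
disjunct says). [cite: Kato2004Asterisque, Thm. 14.5 (3) (p. 236), Thm. 17.4 (3) (p. 273)]
[cite: Delbourgo1998, Prop. 4 (p. 144)] -/
theorem x4SharpThree_conclusion_of_potMult_or_towerSurj
    (hKato : Kato2004.rankZero_padicValNat_sha_le_of_additive_potGood_of_imageContainsSL2)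
    (hDel : Delbourgo1998.prop4_rankZero_pow_dvd_constantCoeff)
    (hGZK : rank_eq_analyticRank_of_analyticRank_le_one) (hmod : hasEntireLFunction_rat)
    (hmodD : nonempty_modularParametrizationData)
    (hL20 : Wuthrich2014.lemma20_surjective_threeAdic_of_semistable)
    (hKatoω : Wuthrich2014.kato_minusEigenCharIdeal_dvd_cyclotomicThree_of_surjective)
    (hr : W.analyticRank = 0) (hX : ClassX4 W 3) (hsurj : Surj W 3)
    (halt : padicValRat 3 W.j < 0 ∨
      ((∀ n : ℕ, W.HasSurjectiveModNGaloisRep (3 ^ n : ℕ)) ∧ ¬ 3 ∣ W.tamagawaProduct))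
    {N : ℕ} [NeZero N] (D : ModularParametrizationData W N) (hc : ¬ (3 : ℤ) ∣ D.maninConstant) :
    ∃ q : ℚ, shaAn W = (q : ℂ) ∧
      (padicValNat 3 W.shaOrder : ℤ) ≤ padicValRat 3 q + padicValNat 3 W.tamagawaProduct := by
  by_cases hj : padicValRat 3 W.j < 0
  · exact x4SharpThree_conclusion_of_potMult W hDel hGZK hmod hmodD hL20 hKatoω hr hX hsurj hj
  · rcases halt with hneg | ⟨htower, htam⟩
    · exact absurd hneg hj
    · exact x4SharpThree_holds_of_potGood_of_towerSurj W hKato hGZK hmod hr hX (not_lt.mp hj) htower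
        htam D hc

/-- **X4♯(3)'s conclusion from the CENSUS CERTIFICATES**: `ord₃ j < 0`, OR [`3 ∤ ∏ c_ℓ` and
(a `j`-witness OR surj(9))]. [cite: Kato2004Asterisque, Thm. 14.5 (3) (p. 236), Thm. 17.4 (3) (p. 273)]
[cite: Delbourgo1998, Prop. 4 (p. 144)] [cite: SilvermanATAEC1994, V.5.3] -/
theorem x4SharpThree_conclusion_of_cert
    (hKato : Kato2004.rankZero_padicValNat_sha_le_of_additive_potGood_of_imageContainsSL2)
    (hDel : Delbourgo1998.prop4_rankZero_pow_dvd_constantCoeff)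
    (hGZK : rank_eq_analyticRank_of_analyticRank_le_one) (hmod : hasEntireLFunction_rat)
    (hmodD : nonempty_modularParametrizationData)
    (hL20 : Wuthrich2014.lemma20_surjective_threeAdic_of_semistable)
    (hKatoω : Wuthrich2014.kato_minusEigenCharIdeal_dvd_cyclotomicThree_of_surjective)
    (hr : W.analyticRank = 0) (hX : ClassX4 W 3) (hsurj : Surj W 3)
    (hcert : padicValRat 3 W.j < 0 ∨
      (¬ 3 ∣ W.tamagawaProduct ∧
        ((∃ q : ℕ, q.Prime ∧ q ≠ 3 ∧ padicValRat q W.j < 0 ∧ ¬ (3 : ℤ) ∣ padicValRat q W.j) ∨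
          W.HasSurjectiveModNGaloisRep 9)))
    {N : ℕ} [NeZero N] (D : ModularParametrizationData W N) (hc : ¬ (3 : ℤ) ∣ D.maninConstant) :
    ∃ q : ℚ, shaAn W = (q : ℂ) ∧
      (padicValNat 3 W.shaOrder : ℤ) ≤ padicValRat 3 q + padicValNat 3 W.tamagawaProduct := by
  by_cases hj : padicValRat 3 W.j < 0
  · exact x4SharpThree_conclusion_of_potMult W hDel hGZK hmod hmodD hL20 hKatoω hr hX hsurj hj
  · rcases hcert with hneg | ⟨htam, hc'⟩
    · exact absurd hneg hj
    · exact x4SharpThree_holds_of_potGood_of_towerSurj W hKato hGZK hmod hr hX (not_lt.mp hj)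
        (towerSurj_three_of_surj_of_jWitness_or_nine W hsurj hc') htam D hc

/-! ### §3 `BSD(E,3)` on the unit rows with ANY of the three certificates -/

/-- **`BSD(E,3)` on every X4♯(3) unit row with a certificate**: X4 ∧ `r_an = 0` ∧ surj(3) ∧
`3 ∤ ∏ c_ℓ` ∧ `#Ш_an` a `3`-unit ∧ [`ord₃ j < 0` ∨ `j`-witness ∨ surj(9)], datum `D` with `3 ∤ c_D`
(used on the potentially good branch only). The (M) branch is additive-p1's
`ClassX4M.bsdp_three_rankZero_of_surj_of_shaAn_unit`; the potentially good branch is Kato's.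
[cite: Kato2004Asterisque, Thm. 14.5 (3) (p. 236), Thm. 17.4 (3) (p. 273)] [cite: Delbourgo1998, Prop. 4 (p. 144)]
[cite: Miller2011LMS, §1 and Def. 1.1] -/
theorem X4RankZero.bsdp_three_of_cert_of_shaAn_unit
    (hKato : Kato2004.rankZero_padicValNat_sha_le_of_additive_potGood_of_imageContainsSL2)
    (hDel : Delbourgo1998.prop4_rankZero_pow_dvd_constantCoeff)
    (hGZK : rank_eq_analyticRank_of_analyticRank_le_one) (hmod : hasEntireLFunction_rat)
    (hmodD : nonempty_modularParametrizationData)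
    (hL20 : Wuthrich2014.lemma20_surjective_threeAdic_of_semistable)
    (hKatoω : Wuthrich2014.kato_minusEigenCharIdeal_dvd_cyclotomicThree_of_surjective)
    (hr : W.analyticRank = 0) (hX : ClassX4 W 3) (hsurj : Surj W 3)
    (hcert : padicValRat 3 W.j < 0 ∨
      (∃ q : ℕ, q.Prime ∧ q ≠ 3 ∧ padicValRat q W.j < 0 ∧ ¬ (3 : ℤ) ∣ padicValRat q W.j) ∨
        W.HasSurjectiveModNGaloisRep 9)
    (htam : ¬ 3 ∣ W.tamagawaProduct)
    {N : ℕ} [NeZero N] (D : ModularParametrizationData W N) (hc : ¬ (3 : ℤ) ∣ D.maninConstant)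
    {q : ℚ} (hq : shaAn W = (q : ℂ)) (hv : padicValRat 3 q = 0) : BSDp W 3 := by
  haveI : Fact (Nat.Prime 3) := ⟨Nat.prime_three⟩
  by_cases hj : padicValRat 3 W.j < 0
  · exact AdditivePotMult.ClassX4M.bsdp_three_rankZero_of_surj_of_shaAn_unit hDel hGZK hmod hmodD
      hL20 hKatoω ⟨hX, hX.2.1, hj⟩ hr hsurj hq hv
  · have hc' : (∃ q : ℕ, q.Prime ∧ q ≠ 3 ∧ padicValRat q W.j < 0 ∧ ¬ (3 : ℤ) ∣ padicValRat q W.j) ∨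
        W.HasSurjectiveModNGaloisRep 9 := by
      rcases hcert with h | h | h
      · exact absurd h hj
      · exact Or.inl h
      · exact Or.inr h
    exact X4RankZero.bsdp_of_shaAn_unit_of_kato W 3 hKato hGZK hmod hr hX (not_lt.mp hj)
      (towerSurj_three_of_surj_of_jWitness_or_nine W hsurj hc') htam D (by exact_mod_cast hc) hq hv

/-- **The typed UPPER HALF `ord₃ #Ш ≤ ord₃ #Ш_an` on every certified row** (also the `3 ∣ #Ш_an`
rows; on the (M) branch no Tamagawa hypothesis is used, on the potentially good branch `3 ∤ ∏ c_ℓ`).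
[cite: Kato2004Asterisque, Thm. 14.5 (3) (p. 236), Thm. 17.4 (3) (p. 273)] [cite: Delbourgo1998, Prop. 4 (p. 144)]
[cite: Miller2011LMS, Def. 1.1] -/
theorem X4RankZero.missingUpperBoundAt_three_of_cert
    (hKato : Kato2004.rankZero_padicValNat_sha_le_of_additive_potGood_of_imageContainsSL2)
    (hDel : Delbourgo1998.prop4_rankZero_pow_dvd_constantCoeff)
    (hGZK : rank_eq_analyticRank_of_analyticRank_le_one) (hmod : hasEntireLFunction_rat)
    (hmodD : nonempty_modularParametrizationData)
    (hL20 : Wuthrich2014.lemma20_surjective_threeAdic_of_semistable)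
    (hKatoω : Wuthrich2014.kato_minusEigenCharIdeal_dvd_cyclotomicThree_of_surjective)
    (hr : W.analyticRank = 0) (hX : ClassX4 W 3) (hsurj : Surj W 3)
    (hcert : padicValRat 3 W.j < 0 ∨
      (∃ q : ℕ, q.Prime ∧ q ≠ 3 ∧ padicValRat q W.j < 0 ∧ ¬ (3 : ℤ) ∣ padicValRat q W.j) ∨
        W.HasSurjectiveModNGaloisRep 9)
    (htam : ¬ 3 ∣ W.tamagawaProduct)
    {N : ℕ} [NeZero N] (D : ModularParametrizationData W N) (hc : ¬ (3 : ℤ) ∣ D.maninConstant) :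
    MissingUpperBoundAt W 3 := by
  haveI : Fact (Nat.Prime 3) := ⟨Nat.prime_three⟩
  by_cases hj : padicValRat 3 W.j < 0
  · exact AdditivePotMult.ClassX4M.missingUpperBoundAt_three_rankZero_of_surj hDel hGZK hmod hmodD
      hL20 hKatoω ⟨hX, hX.2.1, hj⟩ hr hsurj
  · have hc' : (∃ q : ℕ, q.Prime ∧ q ≠ 3 ∧ padicValRat q W.j < 0 ∧ ¬ (3 : ℤ) ∣ padicValRat q W.j) ∨
        W.HasSurjectiveModNGaloisRep 9 := by
      rcases hcert with h | h | h
      · exact absurd h hj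
      · exact Or.inl h
      · exact Or.inr h
    exact X4RankZero.missingUpperBoundAt_of_kato W 3 hKato hGZK hmod hr hX (not_lt.mp hj)
      (towerSurj_three_of_surj_of_jWitness_or_nine W hsurj hc') htam D (by exact_mod_cast hc)

/-- **The `3 ∣ #Ш_an` certified rows: `BSD(E,3)` from the LOWER half alone** (`MissingLowerBoundAt W 3`,
e.g. one `3`-descent certificate through Cassels–Tate): what remains there is EXACTLY the lower half.
[cite: Kato2004Asterisque, Thm. 14.5 (3) (p. 236), Thm. 17.4 (3) (p. 273)] [cite: Delbourgo1998, Prop. 4 (p. 144)]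
[cite: Miller2011LMS, §1 and Def. 1.1] -/
theorem X4RankZero.bsdp_three_of_cert_of_lower
    (hKato : Kato2004.rankZero_padicValNat_sha_le_of_additive_potGood_of_imageContainsSL2)
    (hDel : Delbourgo1998.prop4_rankZero_pow_dvd_constantCoeff)
    (hGZK : rank_eq_analyticRank_of_analyticRank_le_one) (hmod : hasEntireLFunction_rat)
    (hmodD : nonempty_modularParametrizationData)
    (hL20 : Wuthrich2014.lemma20_surjective_threeAdic_of_semistable)
    (hKatoω : Wuthrich2014.kato_minusEigenCharIdeal_dvd_cyclotomicThree_of_surjective)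
    (hr : W.analyticRank = 0) (hX : ClassX4 W 3) (hsurj : Surj W 3)
    (hcert : padicValRat 3 W.j < 0 ∨
      (∃ q : ℕ, q.Prime ∧ q ≠ 3 ∧ padicValRat q W.j < 0 ∧ ¬ (3 : ℤ) ∣ padicValRat q W.j) ∨
        W.HasSurjectiveModNGaloisRep 9)
    (htam : ¬ 3 ∣ W.tamagawaProduct)
    {N : ℕ} [NeZero N] (D : ModularParametrizationData W N) (hc : ¬ (3 : ℤ) ∣ D.maninConstant)
    (hlow : MissingLowerBoundAt W 3) : BSDp W 3 := by
  haveI : Fact (Nat.Prime 3) := ⟨Nat.prime_three⟩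
  exact bsdp_of_missingPPartAt W 3 hGZK (by rw [hr]; exact zero_le_one)
    (missingPPartAt_of_lower_of_upper W 3 hlow
      (X4RankZero.missingUpperBoundAt_three_of_cert W hKato hDel hGZK hmod hmodD hL20 hKatoω hr hX
        hsurj hcert htam D hc))

end Summit.BirchSwinnertonDyer.Rank1Residual.Additive

end
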